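import Summits.BirchSwinnertonDyer.BirchSwinnertonDyer.Theorems.PrintCFramBottomClassIndexLawFiveLeBernoulliIntegral
import HarnessLib

/-!
# Crux `PrintCFram.BottomClassIndexLawFiveLe` (stmt-BirchSwinnertonDyer-20372), line `eisenstein-resource-bdp-line`:
# the BERNOULLI SIDE OF THE LOCUS BOUNDARY, part II — TAMENESS of `ℚ_p`-valued characters and `‖bernoulliOnePrim χ‖_p ≤ 1`
# from ONE unit; Kriz–Li's `hint` discharged
# (cell `bsd-print-cfram`, width seat `bsd-line-cfram-p1-w3` g3; THEOREMS ONLY, `--supports` 20372; BSD is not proved by any of this)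

HONEST FRAMING. Nothing here is a statement about BSD; no stub of the skeleton is closed. Continuation of part I
(`…BernoulliIntegral`: rigidity of `p`-adic roots of unity, the core estimate `‖∑ χ(j) j‖_p ≤ p⁻¹`, integrality at a level
with `ord_p ≤ 1`). Here:

* §3 TAMENESS: the conductor of a `ℚ_p`-valued Dirichlet character is never divisible by `p²` (`p` odd) — an element
  `≡ 1 (mod c/p)` of `ℤ/c` has `p`-th power `1` when `p² ∣ c`, and `ℚ_p` has no non-trivial `p`-th roots of unity, so the
  primitive character would factor through `c/p`.
* §4 the MASTER STATEMENT in the fact's currency: `‖bernoulliOnePrim χ‖_p ≤ 1` for EVERY `ℚ_p`-valued `χ` (ANY level)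
  admitting a unit `u` with `χ(u)·u ≢ 1 (mod p)`; tame form: a unit `u ≡ 1 (mod p)` with `χ(u) ≠ 1` (the prime-to-`p`
  part of `χ` is non-trivial). Pass to the conductor (`p² ∤ c`), then part I.
* §5 the Kriz–Li consequence: for ODD `ψ`, a non-unit class factor `‖B_{1,ψ⁻¹}‖_p ≤ p⁻¹` kills hypothesis (4) of
  Thm. 1.20 over EVERY `K''` as soon as `ψ₀ω⁻¹ = ψ·ε_K·ω⁻¹` is non-trivial at one unit `≡ 1 (mod p)` — the `hint`
  hypothesis of w2 g4's `RegularLocusBernoulliPair.krizLi_bernoulli_hypothesis_fails_of_classFactor` discharged.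

beyond-print theorem: NO (Washington §5 / Kriz–Li Cor. 8.4-type integrality, elementary).
References: [Washington1997] Thm. 4.2, §5.1, Cor. 5.15; [KrizLi2019] §1.5 (1), Thm. 1.20, Cor. 8.4; [Gouvea1993PadicNumbers] §5.8.
-/

set_option autoImplicit false
set_option linter.dupNamespace false

noncomputable section

open scoped Classical
open DirichletCharacter Literature.NumberTheory.LFunctions Literature.NumberTheory.EllipticCurves.KrizLi2019
  Summit.BirchSwinnertonDyer.Rank1Residual.X12.O11.RouteU

namespace Summit.BirchSwinnertonDyer.BirchSwinnertonDyer.Theorems.PrintCFram.BernoulliIntegral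

variable {p : ℕ} [hp : Fact p.Prime]

/-! ## §3 TAMENESS: `p² ∤ conductor` for `ℚ_p`-valued characters (`p` odd) -/

/-- A `p`-th root of unity of `ℚ_p` is congruent to `1` (`ζ^p = ζ̄` in the residue field `𝔽_p`). [cite: Gouvea1993PadicNumbers, §5.8] -/
theorem norm_sub_one_lt_of_pow_prime_eq_one {ζ : ℚ_[p]} (h : ζ ^ p = 1) : ‖ζ - 1‖ < 1 := by
  have hζ1 : ‖ζ‖ ≤ 1 := by
    have h2 := congrArg (‖·‖) h
    simp only [norm_pow, norm_one] at h2
    exact ((pow_eq_one_iff_of_nonneg (norm_nonneg _) hp.out.ne_zero).mp h2).le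
  set z : ℤ_[p] := ⟨ζ, hζ1⟩ with hz
  have hzp : z ^ p = 1 := by apply Subtype.ext; change ζ ^ p = 1; exact h
  have hr : PadicInt.toZMod z = 1 := by
    have h1 : PadicInt.toZMod z ^ p = 1 := by rw [← map_pow, hzp, map_one]
    rwa [ZMod.pow_card] at h1
  have hker : z - 1 ∈ RingHom.ker (PadicInt.toZMod : ℤ_[p] →+* ZMod p) := by
    rw [RingHom.mem_ker, map_sub, hr, map_one, sub_self]
  rw [PadicInt.ker_toZMod] at hker
  have : ‖z - 1‖ < 1 := PadicInt.mem_nonunits.mp hker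
  exact this

/-- **`ℚ_p` has no non-trivial `p`-th roots of unity (`p` odd).** [cite: Gouvea1993PadicNumbers, §5.8 (roots of unity in `ℚ_p`)] -/
theorem eq_one_of_pow_prime_eq_one (hp2 : p ≠ 2) {ζ : ℚ_[p]} (h : ζ ^ p = 1) : ζ = 1 :=
  eq_one_of_pow_eq_one_of_norm_sub_one_lt hp2 hp.out.ne_zero h (norm_sub_one_lt_of_pow_prime_eq_one h)

/-- In `ℤ/(p·d)` with `p ∣ d`: an element `≡ 1 (mod d)` has `p`-th power `1`. [folklore] -/
theorem pow_prime_eq_one_of_cast_eq_one {N d : ℕ} [NeZero d] (hpd : p ∣ d) (hN : N = p * d) (hdN : d ∣ N)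
    (a : ZMod N) (ha : (ZMod.castHom hdN (ZMod d)) a = 1) : a ^ p = 1 := by
  subst hN
  have hpp := hp.out
  have hd0 : d ≠ 0 := NeZero.ne d
  haveI : NeZero (p * d) := ⟨Nat.mul_ne_zero hpp.ne_zero hd0⟩
  have hd1 : 1 < d := lt_of_lt_of_le hpp.one_lt (Nat.le_of_dvd (Nat.pos_of_ne_zero hd0) hpd)
  -- `a.val ≡ 1 (mod d)`
  have hval : a.val % d = 1 := by
    have h1 : ((a.val : ℕ) : ZMod d) = 1 := by
      have := ha
      rw [ZMod.castHom_apply, ZMod.cast_eq_val] at this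
      exact this
    have h2 := (ZMod.natCast_eq_natCast_iff' a.val 1 d).mp (by rw [h1, Nat.cast_one])
    rw [h2, Nat.mod_eq_of_lt hd1]
  -- `a.val = 1 + d·m`
  obtain ⟨m, hm⟩ : ∃ m : ℕ, a.val = 1 + d * m := ⟨a.val / d, by
    have := Nat.mod_add_div a.val d; rw [hval] at this; omega⟩
  -- `(1 + d m)^p ≡ 1 (mod p d)` in `ℤ`
  have hdvd : ((p * d : ℕ) : ℤ) ∣ ((1 + d * m : ℕ) : ℤ) ^ p - 1 := by
    obtain ⟨c, hc⟩ := sq_dvd_add_pow_sub_sub ((d * m : ℕ) : ℤ) (1 : ℤ) p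
    simp only [one_pow, one_mul] at hc
    have e : ((1 + d * m : ℕ) : ℤ) ^ p - 1 =
        ((d * m : ℕ) : ℤ) * (p : ℤ) + ((d * m : ℕ) : ℤ) ^ 2 * c := by
      push_cast at hc ⊢; linear_combination hc
    rw [e]
    obtain ⟨e', he'⟩ := hpd
    refine dvd_add ⟨(m : ℤ), by push_cast; ring⟩ ⟨(e' : ℤ) * (m : ℤ) ^ 2 * c, ?_⟩
    push_cast
    rw [he']; push_cast; ring
  -- back to `ZMod (p d)`
  have ha' : a = ((a.val : ℕ) : ZMod (p * d)) := (ZMod.natCast_zmod_val a).symm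
  rw [ha', hm]
  have h3 : (((1 + d * m : ℕ) : ℤ) : ZMod (p * d)) ^ p - 1 = 0 := by
    obtain ⟨q, hq⟩ := hdvd
    have := congrArg (fun z : ℤ => (z : ZMod (p * d))) hq
    simp only [Int.cast_sub, Int.cast_pow, Int.cast_one, Int.cast_mul, Int.cast_natCast,
      ZMod.natCast_self, zero_mul] at this
    exact_mod_cast this
  have h4 : (((1 + d * m : ℕ) : ℤ) : ZMod (p * d)) = ((1 + d * m : ℕ) : ZMod (p * d)) := by push_cast; rfl
  rw [h4] at h3
  exact sub_eq_zero.mp h3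

/-- **TAMENESS: the conductor of a `ℚ_p`-valued Dirichlet character is not divisible by `p²` (`p` odd).** The
primitive character `χ₀` of conductor `c` with `p² ∣ c` would be trivial on the kernel of `(ℤ/c)ˣ → (ℤ/(c/p))ˣ`
(an elementary abelian `p`-group, on which `χ₀` takes `p`-th roots of unity as values — there are none but `1` in
`ℚ_p`), hence factor through `c/p < c`. [cite: Washington1997, §5.1 and Cor. 5.15 (characters of the first kind)] [cite: Gouvea1993PadicNumbers, §5.8] -/
theorem not_sq_dvd_conductor (hp2 : p ≠ 2) {n : ℕ} [NeZero n] (χ : DirichletCharacter ℚ_[p] n) :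
    ¬ p ^ 2 ∣ χ.conductor := by
  intro hsq
  have hpp := hp.out
  set c := χ.conductor with hc
  haveI : NeZero c := ⟨χ.conductor_ne_zero⟩
  set χ₀ := χ.primitiveCharacter with hχ₀
  have hprim : χ₀.conductor = c := (isPrimitive_def _).mp χ.primitiveCharacter_isPrimitive
  obtain ⟨e, he⟩ := hsq
  -- `c = p · d` with `d = p e`, `p ∣ d`
  set d := p * e with hd
  have hcd : c = p * d := by rw [he, hd, pow_two, mul_assoc]
  have hpd : p ∣ d := ⟨e, rfl⟩
  have hd0 : d ≠ 0 := by intro h0; apply (NeZero.ne c); rw [hcd, h0, mul_zero]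
  haveI : NeZero d := ⟨hd0⟩
  have hdc : d ∣ c := ⟨p, by rw [hcd, mul_comm]⟩
  -- `χ₀` factors through `d`
  have hfac : χ₀.FactorsThrough d := by
    rw [factorsThrough_iff_ker_unitsMap hdc]
    intro x hx
    rw [MonoidHom.mem_ker] at hx ⊢
    -- transport `x` to level `p * d`
    have hx1 : (ZMod.castHom hdc (ZMod d)) (x : ZMod c) = 1 := by
      have := congrArg (fun u : (ZMod d)ˣ => (u : ZMod d)) hx
      simpa [ZMod.unitsMap_def] using this
    have hxp : (x : ZMod c) ^ p = 1 := pow_prime_eq_one_of_cast_eq_one hpd hcd hdc (x : ZMod c) hx1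
    have hζ : χ₀ (x : ZMod c) ^ p = 1 := by rw [← map_pow, hxp, map_one]
    have h1 : χ₀ (x : ZMod c) = 1 := eq_one_of_pow_prime_eq_one hp2 hζ
    exact Units.ext (by simpa using h1)
  -- contradiction with primitivity: `c ≤ d < c`
  have hle : c ≤ d := by
    rw [← hprim]
    exact Nat.sInf_le ((mem_conductorSet_iff _).mpr hfac)
  have hlt : d < c := by
    rw [hcd]; exact lt_mul_left (Nat.pos_of_ne_zero hd0) hpp.one_lt
  omega

/-- Corollary: `ord_p(conductor) ≤ 1`. [cite: Washington1997, Cor. 5.15] -/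
theorem padicValNat_conductor_le_one (hp2 : p ≠ 2) {n : ℕ} [NeZero n] (χ : DirichletCharacter ℚ_[p] n) :
    padicValNat p χ.conductor ≤ 1 := by
  by_contra h
  push Not at h
  have : p ^ 2 ∣ χ.conductor := by
    haveI : NeZero χ.conductor := ⟨χ.conductor_ne_zero⟩
    exact (padicValNat_dvd_iff_le (NeZero.ne _)).mpr h
  exact not_sq_dvd_conductor hp2 χ this

/-! ## §4 The master statement: `‖bernoulliOnePrim χ‖_p ≤ 1` from ONE unit -/

/-- `bernoulliOnePrim 1 = −½` has norm `1` for odd `p`. [cite: DiamondShurman2005, §4.7 (4.30)] -/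
theorem norm_bernoulliOnePrim_one (hp2 : p ≠ 2) {n : ℕ} [NeZero n] :
    ‖bernoulliOnePrim (1 : DirichletCharacter ℚ_[p] n)‖ = 1 := by
  rw [bernoulliOnePrim_one, norm_neg, norm_inv]
  have : ‖(2 : ℚ_[p])‖ = 1 := by
    have h := Padic.norm_natCast_eq_one_iff.mpr ((Nat.coprime_primes hp.out Nat.prime_two).mpr hp2)
    simpa using h
  rw [this, inv_one]

/-- **MASTER STATEMENT.** Let `χ` be a `ℚ_p`-valued Dirichlet character of ANY level `n` (`p` odd) and `u` a unit of
`ℤ/n` with `χ(u)·u ≢ 1 (mod p)`, i.e. `‖χ(u)·u.val − 1‖_p = 1`. Then the Bernoulli number of the PRIMITIVE character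
inducing `χ` is `p`-integral: `‖bernoulliOnePrim χ‖_p ≤ 1`. (Pass to the conductor `c`: `p² ∤ c` by tameness; if
`p ∤ c` the number is trivially integral; if `p ∥ c` use the core estimate with the image of `u`.)
[cite: Washington1997, Thm. 4.2, §5.1, Cor. 5.15] [cite: KrizLi2019, §1.5 display (1) (p. 7), Thm. 1.20 (p. 8)] -/
theorem norm_bernoulliOnePrim_le_one_of_unit (hp2 : p ≠ 2) {n : ℕ} [NeZero n] (χ : DirichletCharacter ℚ_[p] n)
    (u : (ZMod n)ˣ) (hu : ‖χ (u : ZMod n) * (((u : ZMod n).val : ℕ) : ℚ_[p]) - 1‖ = 1) :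
    ‖bernoulliOnePrim χ‖ ≤ 1 := by
  have hpp := hp.out
  set c := χ.conductor with hc
  haveI hc0 : NeZero c := ⟨χ.conductor_ne_zero⟩
  set χ₀ := χ.primitiveCharacter with hχ₀
  have hlift : changeLevel χ.conductor_dvd_level χ₀ = χ := χ.changeLevel_primitiveCharacter
  have hB : bernoulliOnePrim χ = generalizedBernoulli 1 χ₀ := by rw [bernoulliOnePrim_def]
  by_cases h1 : χ₀ = 1
  · have hχ1 : χ = 1 := by rw [← hlift, h1, changeLevel_one]
    rw [hχ1, norm_bernoulliOnePrim_one hp2]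
  rw [hB]
  -- the image unit at level `c`
  set u₀ : (ZMod c)ˣ := ZMod.unitsMap χ.conductor_dvd_level u with hu₀
  have hχu : χ (u : ZMod n) = χ₀ (u₀ : ZMod c) := by
    conv_lhs => rw [← hlift]
    rw [changeLevel_eq_cast_of_dvd, hu₀, ZMod.unitsMap_val]
  have hval : ((u₀ : ZMod c).val : ℕ) = (u : ZMod n).val % c := by
    rw [hu₀, ZMod.unitsMap_val, ZMod.cast_eq_val, ZMod.val_natCast]
  by_cases hpc : p ∣ c
  · have hv : padicValNat p c = 1 := by
      have h1' : 1 ≤ padicValNat p c := (padicValNat_dvd_iff_le (NeZero.ne c)).mp (by simpa using hpc)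
      have h2' := padicValNat_conductor_le_one hp2 χ
      rw [← hc] at h2'
      omega
    refine norm_generalizedBernoulli_one_le_one_of_unit χ₀ h1 hv u₀ ?_
    -- `‖χ₀(u₀)·u₀.val − 1‖ = 1` from `hu`: `u₀.val ≡ u.val (mod c)`, `p ∣ c`
    have hdiff : ‖(((u₀ : ZMod c).val : ℕ) : ℚ_[p]) - (((u : ZMod n).val : ℕ) : ℚ_[p])‖ < 1 := by
      have hdvd : (p : ℤ) ∣ (((u₀ : ZMod c).val : ℕ) : ℤ) - (((u : ZMod n).val : ℕ) : ℤ) := by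
        rw [hval]
        refine dvd_trans (Int.natCast_dvd_natCast.mpr hpc) ?_
        rw [Int.natCast_mod, Int.emod_def]
        exact ⟨-((((u : ZMod n).val : ℕ) : ℤ) / (c : ℤ)), by ring⟩
      have := Padic.norm_intCast_lt_one_iff.mpr hdvd
      push_cast at this
      exact this
    have hlt : ‖χ₀ (u₀ : ZMod c) * ((((u₀ : ZMod c).val : ℕ) : ℚ_[p]) - (((u : ZMod n).val : ℕ) : ℚ_[p]))‖ < 1 := by
      rw [norm_mul]
      calc ‖χ₀ (u₀ : ZMod c)‖ * _ ≤ 1 * _ := mul_le_mul_of_nonneg_right (norm_apply_le_one χ₀ _) (norm_nonneg _)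
        _ < 1 := by rw [one_mul]; exact hdiff
    have e : χ₀ (u₀ : ZMod c) * (((u₀ : ZMod c).val : ℕ) : ℚ_[p]) - 1 =
        (χ (u : ZMod n) * (((u : ZMod n).val : ℕ) : ℚ_[p]) - 1) +
          χ₀ (u₀ : ZMod c) * ((((u₀ : ZMod c).val : ℕ) : ℚ_[p]) - (((u : ZMod n).val : ℕ) : ℚ_[p])) := by
      rw [hχu]; ring
    rw [e]
    have hne : ‖χ (u : ZMod n) * (((u : ZMod n).val : ℕ) : ℚ_[p]) - 1‖ ≠
        ‖χ₀ (u₀ : ZMod c) * ((((u₀ : ZMod c).val : ℕ) : ℚ_[p]) - (((u : ZMod n).val : ℕ) : ℚ_[p]))‖ := by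
      rw [hu]; exact (ne_of_lt hlt).symm
    rw [Padic.add_eq_max_of_ne hne, hu, max_eq_left hlt.le]
  · exact norm_generalizedBernoulli_one_le_one_of_not_dvd χ₀ h1 hpc

/-- **MASTER STATEMENT, tame form.** If some unit `u ≡ 1 (mod p)` of `ℤ/n` has `χ(u) ≠ 1` — i.e. the prime-to-`p`
part of `χ` is non-trivial — then `‖bernoulliOnePrim χ‖_p ≤ 1` (`p` odd). This is the shape of Kriz–Li's second
Bernoulli character `ψ₀ω⁻¹ = ψ·ε_K·ω⁻¹` whenever `ψ·ε_K` is not a power of `ω`.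
[cite: Washington1997, Thm. 4.2, §5.1, Cor. 5.15] [cite: KrizLi2019, Thm. 1.20 (p. 8) and Cor. 8.4] -/
theorem norm_bernoulliOnePrim_le_one_of_unit_one_mod (hp2 : p ≠ 2) {n : ℕ} [NeZero n]
    (χ : DirichletCharacter ℚ_[p] n) (u : (ZMod n)ˣ) (hu1 : (((u : ZMod n).val : ℕ) : ZMod p) = 1)
    (hne : χ (u : ZMod n) ≠ 1) : ‖bernoulliOnePrim χ‖ ≤ 1 := by
  refine norm_bernoulliOnePrim_le_one_of_unit hp2 χ u ?_
  have h1 : ‖χ (u : ZMod n) - 1‖ = 1 := norm_apply_sub_one_eq_one hp2 χ u hne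
  have h2 : ‖(((u : ZMod n).val : ℕ) : ℚ_[p]) - 1‖ < 1 := by
    have hmod : (u : ZMod n).val % p = 1 % p := (ZMod.natCast_eq_natCast_iff' _ _ _).mp (by rw [hu1, Nat.cast_one])
    have hdvd : (p : ℤ) ∣ (((u : ZMod n).val : ℕ) : ℤ) - 1 := by
      have := (Nat.modEq_iff_dvd.mp (hmod.symm : 1 ≡ (u : ZMod n).val [MOD p]))
      -- `Nat.modEq_iff_dvd : a ≡ b [MOD n] ↔ (n:ℤ) ∣ b - a`
      simpa using this
    have := Padic.norm_intCast_lt_one_iff.mpr hdvd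
    push_cast at this
    exact this
  have hlt : ‖χ (u : ZMod n) * ((((u : ZMod n).val : ℕ) : ℚ_[p]) - 1)‖ < 1 := by
    rw [norm_mul]
    calc ‖χ (u : ZMod n)‖ * _ ≤ 1 * _ := mul_le_mul_of_nonneg_right (norm_apply_le_one χ _) (norm_nonneg _)
      _ < 1 := by rw [one_mul]; exact h2
  have e : χ (u : ZMod n) * (((u : ZMod n).val : ℕ) : ℚ_[p]) - 1 =
      (χ (u : ZMod n) - 1) + χ (u : ZMod n) * ((((u : ZMod n).val : ℕ) : ℚ_[p]) - 1) := by ring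
  rw [e]
  have hne' : ‖χ (u : ZMod n) - 1‖ ≠ ‖χ (u : ZMod n) * ((((u : ZMod n).val : ℕ) : ℚ_[p]) - 1)‖ := by
    rw [h1]; exact (ne_of_lt hlt).symm
  rw [Padic.add_eq_max_of_ne hne', h1, max_eq_left hlt.le]

/-! ## §5 Kriz–Li: a non-unit CLASS factor kills hypothesis (4) over every `K''` (the `hint` of w2 g4 discharged) -/

/-- **The class factor is necessary — `hint` discharged.** For an ODD `ψ` (any level `f`), any `ε_K` (level `d`) and
any `ω` (level `p`, `p` odd): if the class factor is a non-unit, `‖B_{1,ψ⁻¹}‖_p ≤ p⁻¹`, and the second Bernoulli character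
`ψ₀ω⁻¹ = (ψ·ε_K)·ω⁻¹` (level `f·d·p`) is non-trivial at SOME unit `u ≡ 1 (mod p)` (its prime-to-`p` part is
non-trivial — automatic when `ψ·ε_K` is not a power of `ω`), then Kriz–Li's hypothesis (4) FAILS:
`‖B_{1,ψ₀⁻¹ε_K} · B_{1,ψ₀ω⁻¹}‖_p ≤ p⁻¹`. [cite: KrizLi2019, Thm. 1.20 (p. 8, hypothesis (4)) and Cor. 8.4] [cite: Washington1997, §5.1] -/
theorem krizLi_bernoulli_hypothesis_fails_of_classFactor_of_unit (hp2 : p ≠ 2) {f d : ℕ} [NeZero f] [NeZero d]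
    (ψ : DirichletCharacter ℚ_[p] f) (εK : DirichletCharacter ℚ_[p] d) (ω : DirichletCharacter ℚ_[p] p)
    (hψ : ¬ ψ.Even) (hcls : ‖bernoulliOnePrim ψ⁻¹‖ ≤ (p : ℝ)⁻¹)
    (u : (ZMod (f * d * p))ˣ) (hu1 : (((u : ZMod (f * d * p)).val : ℕ) : ZMod p) = 1)
    (hne : bernoulliCharTwo ψ εK ω (u : ZMod (f * d * p)) ≠ 1) :
    ‖bernoulliOnePrim (bernoulliCharOne ψ εK) * bernoulliOnePrim (bernoulliCharTwo ψ εK ω)‖ ≤ (p : ℝ)⁻¹ :=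
  RegularLocusBernoulliPair.krizLi_bernoulli_hypothesis_fails_of_classFactor ψ εK ω hψ hcls
    (norm_bernoulliOnePrim_le_one_of_unit_one_mod hp2 _ u hu1 hne)

end Summit.BirchSwinnertonDyer.BirchSwinnertonDyer.Theorems.PrintCFram.BernoulliIntegral

end
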